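import Mathlib.RingTheory.Ideal.Height
import Mathlib.RingTheory.KrullDimension.Polynomial
import Mathlib.RingTheory.KrullDimension.Field
import Summits.ResolutionOfSingularities.ResolutionOfSingularities.Theorems.RadicialJungCleanModelsStubNodalBlowupChartUnit
import Summits.ResolutionOfSingularities.ResolutionOfSingularities.Theorems.RadicialJungCleanModelsStubExtendParameter
import HarnessLib

/-!
# Stub `stub_nodalBlowup`, part 2/3: the chart computation
(crux stmt-ResolutionOfSingularities-15917, `CleanModels`, line `Sketch` rev 7)

Route `ResolutionOfSingularities/RadicialJung`, crux item `CleanModels`, line `Sketch` (rev 7),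
stub `stub_nodalBlowup` (nodal points are cured by one point blow-up): the local algebra in ONE
chart of the point blow-up of a two-dimensional regular local ring, for ABSTRACT chart data as
in `BlowupChartRsop.lean` — a Noetherian `A` with `ψ : O → A`, elements `ug_j` with
`ψ(c_j) = ψ(c_i) ug_j`, `ψ(c_i)` a non-zero-divisor, `ε : κ[T] ≅ A/(ψ c_i)` (`κ = O/𝔪`) with
`ε(r̄) = ψ r`, `ε(T) = ug_j`, a prime `𝔓 ⊂ A` over `𝔪` and a localization `L = A_𝔓`; the Rees
chart `chartRing c i` of `Bl_𝔪 Spec O` with `chartBase`, `chartGen`, `chartQuotEquiv` is such a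
datum, and the local rings of the blowing up of a point of a surface are such `L`
(`IsBlowup.exists_reesChart_stalk`).

* `chart_loose` — let `char O = p`, `dim O = 2`, `𝔪 = (c_i, c_j)`, `u, cc ∈ O^×`, `p ∤ e`,
  `f₁ ≡ cc c_i c_j (mod 𝔪³)`. Then `ψ f₁ = ψ(c_i)² f̃` with `f̃ = cc ug_j + c_i r` (`𝔪 A = c_i A`),
  and `u f̃^e c_i^{2e mod p}` is LOOSELY CLEAN in `L`:
  - `ug_j ∈ 𝔓` (the origin of the chart): `(c_i, ug_j)` is part of a regular system of
    parameters of `L` (`isRsopPart_chartFamily`) and `dim L = dim L/(c_i) + 1 ≤ dim κ[T] + 1 = 2`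
    (`L/(c_i)` is a localization of `A/(c_i) ≅ κ[T]`,
    `IsLocalization.AtPrime.ringKrullDim_eq_height`), so `𝔪_L = (c_i, ug_j) = (c_i, f̃)` and
    `dim L = 2`: toroidal along `(c_i, f̃)` with exponents
    `(2e mod p, e)` (or along `f̃` alone if `p ∣ 2e`);
  - `ug_j ∉ 𝔓`, `p ∤ 2e`: `f̃` is a unit, `c_i ∈ 𝔪_L ∖ 𝔪_L²` extends to a regular system of
    parameters (`stub_extendParameter`): toroidal along `c_i` with unit `u f̃^e`;
  - `ug_j ∉ 𝔓`, `p ∣ 2e`: `u f̃^e` is a unit of regular type (i) or (ii) by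
    `chart_unit_obstruction` (part 1/3).
-/

noncomputable section

set_option linter.dupNamespace false -- mandated namespace of this single-conjunct summit

open IsLocalRing
open Literature.AlgebraicGeometry.Resolution

namespace Summit.ResolutionOfSingularities.ResolutionOfSingularities.Theorems.RadicialJung.CleanModels

universe u

/-- For a two-dimensional regular local ring with `𝔪 = (c₀, c₁)`: the same data in the format
`𝔪 = (c, w)`, `emb.dim = 2 + 0` of `BlowupChartRsop.lean` (with `w` the empty family). -/
theorem rsop_pair_aux {O : Type u} [CommRing O] [IsRegularLocalRing O] (c : Fin 2 → O)
    (hc : Ideal.span (Set.range c) = maximalIdeal O) (hdim : ringKrullDim O = (2 : WithBot ℕ∞)) :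
    Ideal.span (Set.range (Fin.append c (Fin.elim0 : Fin 0 → O))) = maximalIdeal O ∧
      (maximalIdeal O).spanFinrank = 2 + 0 := by
  constructor
  · have hsurj : Function.Surjective (Fin.cast (Nat.add_zero 2) : Fin (2 + 0) → Fin 2) :=
      fun k => ⟨Fin.cast (Nat.add_zero 2).symm k, Fin.ext rfl⟩
    rw [Fin.append_elim0, hsurj.range_comp, hc]
  · have h := IsRegularLocalRing.spanFinrank_maximalIdeal (R := O)
    rw [hdim] at h
    exact_mod_cast h

/-- **The chart computation.** Let `O` be a regular local ring of characteristic `p` and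
dimension `2` with `𝔪 = (c₀, c₁)`, `x = u f₁^e` with `u, cc` units, `p ∤ e` and
`f₁ ≡ cc c_i c_j (mod 𝔪³)` (`{i, j} = {0, 1}`). In the chart `A = O[c_j/c_i]` of the blowing up
of `𝔪` one has `f₁ = c_i² f̃` with `f̃ = cc (c_j/c_i) + c_i r`; and at every prime `𝔓` of `A`
over `𝔪`, in the local ring `L = A_𝔓`, the element `u f̃^e c_i^{2e mod p}` (which is
`(c_i^{-⌊2e/p⌋})^p x` in the fraction field) is loosely clean: toroidal along `(c_i, f̃)` if
`c_j/c_i ∈ 𝔓`, toroidal along `c_i` with unit `u f̃^e` if `c_j/c_i ∉ 𝔓` and `p ∤ 2e`, and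
otherwise a unit of regular type (i)/(ii) (`chart_unit_obstruction`). -/
theorem chart_loose {O : Type u} [CommRing O] [IsRegularLocalRing O] (c : Fin 2 → O) (i : Fin 2)
    {A : Type u} [CommRing A] [IsNoetherianRing A] (L : Type u) [CommRing L] [IsLocalRing L]
    (ψ : O →+* A) (ug : Fin 2 → A) (hnzd : ψ (c i) ∈ nonZeroDivisors A)
    (ε : MvPolynomial {j : Fin 2 // j ≠ i} (O ⧸ Ideal.span (Set.range c)) ≃+*
      A ⧸ Ideal.span {ψ (c i)})
    (hεC : ∀ r : O, ε (MvPolynomial.C (Ideal.Quotient.mk (Ideal.span (Set.range c)) r)) =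
      Ideal.Quotient.mk _ (ψ r))
    (hεX : ∀ j : {j : Fin 2 // j ≠ i}, ε (MvPolynomial.X j) = Ideal.Quotient.mk _ (ug j.1))
    (𝔓 : Ideal A) [𝔓.IsPrime] (h𝔓 : 𝔓.comap ψ = maximalIdeal O)
    [Algebra A L] [IsLocalization.AtPrime L 𝔓] (p : ℕ) (hp : p.Prime) [CharP O p]
    (hc : Ideal.span (Set.range c) = maximalIdeal O) (hdim : ringKrullDim O = (2 : WithBot ℕ∞))
    (j : Fin 2) (hij : j ≠ i) (hWj : ψ (c j) = ψ (c i) * ug j) (u f₁ cc : O) (e : ℕ)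
    (hu : IsUnit u) (hcc : IsUnit cc) (he : ¬ p ∣ e)
    (hf : f₁ - cc * c i * c j ∈ maximalIdeal O ^ 3) :
    ∃ (ft : A) (y : L),
      ψ f₁ = ψ (c i) ^ 2 * ft ∧
      y = algebraMap A L (ψ u * ft ^ e * ψ (c i) ^ (2 * e % p)) ∧
      ((∃ (d m : ℕ) (hmd : m ≤ d) (t : Fin d → L) (a : Fin m → ℕ) (u' : L), IsUnit u' ∧
          Ideal.span (Set.range t) = maximalIdeal L ∧ ringKrullDim L = (d : WithBot ℕ∞) ∧
          0 < m ∧ (∀ k, ¬ p ∣ a k) ∧ y = u' * ∏ k : Fin m, t (Fin.castLE hmd k) ^ (a k)) ∨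
        (∃ u' : L, IsUnit u' ∧ y = u' ∧ ∀ c' : L, u' - c' ^ p ∉ maximalIdeal L) ∨
        (∃ s c' : L, y = s ∧ s - c' ^ p ∈ maximalIdeal L ∧ s - c' ^ p ∉ maximalIdeal L ^ 2)) := by
  classical
  obtain ⟨hz, hd⟩ := rsop_pair_aux c hc hdim
  -- membership in `𝔓` of elements of `O`
  have hψmem : ∀ r, ψ r ∈ 𝔓 ↔ r ∈ maximalIdeal O := fun r => by
    rw [← h𝔓, Ideal.mem_comap]
  have hcmem : ∀ k, c k ∈ maximalIdeal O := fun k => hc ▸ Ideal.subset_span ⟨k, rfl⟩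
  have hci𝔓 : ψ (c i) ∈ 𝔓 := (hψmem _).mpr (hcmem i)
  have hu𝔓 : ψ u ∉ 𝔓 := fun h => (IsLocalRing.mem_maximalIdeal _ |>.mp ((hψmem u).mp h)) hu
  have hcc𝔓 : ψ cc ∉ 𝔓 := fun h =>
    (IsLocalRing.mem_maximalIdeal _ |>.mp ((hψmem cc).mp h)) hcc
  have hKle : Ideal.span {ψ (c i)} ≤ 𝔓 := by
    rw [Ideal.span_le, Set.singleton_subset_iff]
    exact hci𝔓
  -- `ψ(𝔪) ⊆ (ψ c_i)` and `f₁ = c_i² f̃`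
  have hmapm : (maximalIdeal O).map ψ ≤ Ideal.span {ψ (c i)} := by
    rw [← hc, Ideal.map_span, Ideal.span_le]
    rintro _ ⟨_, ⟨k, rfl⟩, rfl⟩
    rcases fin_two_eq_or_eq i j hij k with rfl | rfl
    · exact Ideal.mem_span_singleton_self _
    · rw [SetLike.mem_coe, hWj]
      exact Ideal.mul_mem_right _ _ (Ideal.mem_span_singleton_self _)
  have hmap3 : (maximalIdeal O ^ 3).map ψ ≤ Ideal.span {ψ (c i)} ^ 3 := by
    rw [Ideal.map_pow]
    exact Ideal.pow_right_mono hmapm 3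
  have h3 := hmap3 (Ideal.mem_map_of_mem ψ hf)
  rw [Ideal.span_singleton_pow, Ideal.mem_span_singleton'] at h3
  obtain ⟨r, hr⟩ := h3
  refine ⟨ψ cc * ug j + ψ (c i) * r, _, ?_, rfl, ?_⟩
  · rw [map_sub, map_mul, map_mul, hWj] at hr
    have hr' := sub_eq_iff_eq_add.mp hr.symm
    rw [hr']
    ring
  -- the local ring `L`: regular, `c_i ∈ 𝔪_L ∖ 𝔪_L²`, `dim L = dim L/(c_i) + 1`
  have hrs1 := isRsopPart_chartFamily c i Fin.elim0 hz hd L ψ ug hnzd ε hεC hεX 𝔓 h𝔓 (a := 0)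
    Fin.elim0 (Function.injective_of_subsingleton _) (fun k => k.elim0)
  haveI : IsRegularLocalRing L := hrs1.isRegularLocalRing
  have hmemL : ∀ b, algebraMap A L b ∈ maximalIdeal L ↔ b ∈ 𝔓 := fun b =>
    IsLocalization.AtPrime.to_map_mem_maximal_iff L 𝔓 b
  have hunitL : ∀ b, b ∉ 𝔓 → IsUnit (algebraMap A L b) := fun b hb =>
    IsLocalization.map_units L ⟨b, show b ∈ 𝔓.primeCompl from hb⟩
  have ht₁mem : algebraMap A L (ψ (c i)) ∈ maximalIdeal L := (hmemL _).mpr hci𝔓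
  have ht₁sq : algebraMap A L (ψ (c i)) ∉ maximalIdeal L ^ 2 := by
    have := hrs1.not_mem_sq 0
    simpa [chartFamily] using this
  have hfam1 : Ideal.span (Set.range (chartFamily c i Fin.elim0 L ψ ug
      (Fin.elim0 : Fin 0 → {k : Fin 2 // k ≠ i}))) =
      (Ideal.span {ψ (c i)}).map (algebraMap A L) := by
    rw [span_range_chartFamily]
    simp
  have hdim1 : ringKrullDim (L ⧸ (Ideal.span {ψ (c i)}).map (algebraMap A L)) + 1 =
      ringKrullDim L := by
    have := hrs1.ringKrullDim_quotient_add
    rwa [hfam1] at this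
  -- arithmetic of the exponent
  have hr'lt : 2 * e % p < p := Nat.mod_lt _ hp.pos
  have hr'ndvd : 2 * e % p ≠ 0 → ¬ p ∣ 2 * e % p := fun h0 hdvd =>
    h0 (Nat.eq_zero_of_dvd_of_lt hdvd hr'lt)
  -- the prime `𝔓/(c_i)` of the exceptional curve `A/(c_i) ≅ κ[T]`
  haveI hpbar : (𝔓.map (Ideal.Quotient.mk (Ideal.span {ψ (c i)}))).IsPrime :=
    Ideal.map_isPrime_of_surjective Ideal.Quotient.mk_surjective (by rwa [Ideal.mk_ker])
  have hmemq : ∀ x : A, Ideal.Quotient.mk (Ideal.span {ψ (c i)}) x ∈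
      𝔓.map (Ideal.Quotient.mk (Ideal.span {ψ (c i)})) ↔ x ∈ 𝔓 := fun x => by
    rw [← Ideal.mem_comap, Ideal.comap_map_of_surjective _ Ideal.Quotient.mk_surjective,
      ← RingHom.ker_eq_comap_bot, Ideal.mk_ker, sup_eq_left.mpr hKle]
  by_cases hW : ug j ∈ 𝔓
  · -- Case A: the origin of the chart; `(c_i, f̃)` is a regular system of parameters of `L`
    -- `dim L ≤ 2`: `L/(c_i)` is the localization of `A/(c_i) ≅ κ[T]` at `𝔓/(c_i)`
    have hM : Algebra.algebraMapSubmonoid (A ⧸ Ideal.span {ψ (c i)}) 𝔓.primeCompl =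
        (𝔓.map (Ideal.Quotient.mk (Ideal.span {ψ (c i)}))).primeCompl := by
      ext b
      constructor
      · rintro ⟨x, hx, rfl⟩
        exact fun h => hx ((hmemq x).mp h)
      · intro hb
        obtain ⟨x, rfl⟩ := Ideal.Quotient.mk_surjective b
        exact ⟨x, fun h => hb ((hmemq x).mpr h), rfl⟩
    haveI : IsLocalization.AtPrime (L ⧸ (Ideal.span {ψ (c i)}).map (algebraMap A L))
        (𝔓.map (Ideal.Quotient.mk (Ideal.span {ψ (c i)}))) := by
      have := (inferInstance : IsLocalization (Algebra.algebraMapSubmonoid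
        (A ⧸ Ideal.span {ψ (c i)}) 𝔓.primeCompl) (L ⧸ (Ideal.span {ψ (c i)}).map (algebraMap A L)))
      rwa [hM] at this
    have hdimle : ringKrullDim L ≤ 2 := by
      have h1 := IsLocalization.AtPrime.ringKrullDim_eq_height
        (𝔓.map (Ideal.Quotient.mk (Ideal.span {ψ (c i)})))
        (L ⧸ (Ideal.span {ψ (c i)}).map (algebraMap A L))
      have h2 : ((𝔓.map (Ideal.Quotient.mk (Ideal.span {ψ (c i)}))).height : WithBot ℕ∞) ≤
          ringKrullDim (A ⧸ Ideal.span {ψ (c i)}) :=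
        Ideal.height_le_ringKrullDim_of_ne_top hpbar.ne_top
      have hfield : IsField (O ⧸ Ideal.span (Set.range c)) :=
        (Ideal.Quotient.maximal_ideal_iff_isField_quotient _).mp (hc ▸ maximalIdeal.isMaximal O)
      have h3 : ringKrullDim (A ⧸ Ideal.span {ψ (c i)}) = 1 := by
        rw [← ringKrullDim_eq_of_ringEquiv ε, MvPolynomial.ringKrullDim_of_isNoetherianRing,
          natCard_ne_eq_one i j hij, ringKrullDim_eq_zero_of_isField hfield]
        rfl
      rw [← hdim1, h1]
      calc ((𝔓.map (Ideal.Quotient.mk (Ideal.span {ψ (c i)}))).height : WithBot ℕ∞) + 1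
          ≤ ringKrullDim (A ⧸ Ideal.span {ψ (c i)}) + 1 := add_le_add h2 le_rfl
        _ = 2 := by rw [h3]; rfl
    -- hence `(c_i, ug_j)` is a regular system of parameters and `dim L = 2`
    have hrs2 := isRsopPart_chartFamily c i Fin.elim0 hz hd L ψ ug hnzd ε hεC hεX 𝔓 h𝔓 (a := 1)
      (fun _ => ⟨j, hij⟩) (fun a b _ => Subsingleton.elim a b) (fun _ => hW)
    have hfam2 : chartFamily c i Fin.elim0 L ψ ug
        (fun _ : Fin 1 => (⟨j, hij⟩ : {k : Fin 2 // k ≠ i})) =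
        ![algebraMap A L (ψ (c i)), algebraMap A L (ug j)] := by
      funext k
      fin_cases k <;> rfl
    obtain ⟨-, e', yv, hdimL, hspan⟩ := hrs2
    have he' : e' = 0 := by
      rw [hdimL] at hdimle
      have h' : ((1 + 0 + 1 + e' : ℕ) : WithBot ℕ∞) ≤ ((2 : ℕ) : WithBot ℕ∞) := hdimle
      have h'' := WithBot.coe_le_coe.mp h'
      norm_cast at h''
      omega
    subst he'
    have hdimL2 : ringKrullDim L = ((2 : ℕ) : WithBot ℕ∞) := by rw [hdimL]
    rw [Set.range_eq_empty yv, Set.union_empty, hfam2, Matrix.range_cons_cons_empty,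
      Ideal.span_insert] at hspan
    -- replace `ug_j` by `f̃ = cc ug_j + c_i r`
    have hspan2 : Ideal.span {algebraMap A L (ψ (c i))} ⊔
        Ideal.span {algebraMap A L (ψ cc * ug j + ψ (c i) * r)} = maximalIdeal L := by
      rw [← hspan]
      obtain ⟨v, hv⟩ := (hunitL _ hcc𝔓).exists_left_inv
      apply le_antisymm
      · refine sup_le le_sup_left ?_
        rw [Ideal.span_le, Set.singleton_subset_iff, map_add, map_mul, map_mul]
        exact Ideal.add_mem _
          (Ideal.mem_sup_right (Ideal.mul_mem_left _ _ (Ideal.mem_span_singleton_self _)))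
          (Ideal.mem_sup_left (Ideal.mul_mem_right _ _ (Ideal.mem_span_singleton_self _)))
      · refine sup_le le_sup_left ?_
        rw [Ideal.span_le, Set.singleton_subset_iff]
        have hWeq : algebraMap A L (ug j) = v * algebraMap A L (ψ cc * ug j + ψ (c i) * r) -
            v * algebraMap A L r * algebraMap A L (ψ (c i)) := by
          rw [map_add, map_mul, map_mul]
          linear_combination (-(algebraMap A L (ug j))) * hv
        rw [SetLike.mem_coe, hWeq]
        exact Ideal.sub_mem _
          (Ideal.mem_sup_right (Ideal.mul_mem_left _ _ (Ideal.mem_span_singleton_self _)))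
          (Ideal.mem_sup_left (Ideal.mul_mem_left _ _ (Ideal.mem_span_singleton_self _)))
    by_cases hr0 : 2 * e % p = 0
    · refine Or.inl ⟨2, 1, by norm_num,
        ![algebraMap A L (ψ cc * ug j + ψ (c i) * r), algebraMap A L (ψ (c i))], ![e],
        algebraMap A L (ψ u), hunitL _ hu𝔓, ?_, hdimL2, one_pos, ?_, ?_⟩
      · rw [Matrix.range_cons_cons_empty, Set.pair_comm, Ideal.span_insert, hspan2]
      · intro k
        fin_cases k
        exact he
      · rw [Fin.prod_univ_one, hr0, pow_zero, mul_one, map_mul, map_pow]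
        rfl
    · refine Or.inl ⟨2, 2, le_rfl,
        ![algebraMap A L (ψ (c i)), algebraMap A L (ψ cc * ug j + ψ (c i) * r)],
        ![2 * e % p, e], algebraMap A L (ψ u), hunitL _ hu𝔓, ?_, hdimL2, two_pos, ?_, ?_⟩
      · rw [Matrix.range_cons_cons_empty, Ideal.span_insert, hspan2]
      · intro k
        fin_cases k
        · exact hr'ndvd hr0
        · exact he
      · rw [Fin.prod_univ_two, map_mul, map_mul, map_pow, map_pow]
        simp only [Fin.castLE_rfl, id_eq, Matrix.cons_val_zero, Matrix.cons_val_one]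
        ring
  · -- Case B: `f̃` is a unit at `𝔓`
    have hft𝔓 : ψ cc * ug j + ψ (c i) * r ∉ 𝔓 := by
      intro h
      have h' : ψ cc * ug j ∈ 𝔓 := (Submodule.add_mem_iff_left 𝔓 (𝔓.mul_mem_right r hci𝔓)).mp h
      rcases (‹𝔓.IsPrime›.mem_or_mem h') with h'' | h''
      · exact hcc𝔓 h''
      · exact hW h''
    have hs𝔓 : ψ u * (ψ cc * ug j + ψ (c i) * r) ^ e ∉ 𝔓 := fun h => by
      rcases (‹𝔓.IsPrime›.mem_or_mem h) with h' | h'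
      · exact hu𝔓 h'
      · exact hft𝔓 (‹𝔓.IsPrime›.mem_of_pow_mem _ h')
    have hunit := hunitL _ hs𝔓
    by_cases hr0 : 2 * e % p = 0
    · -- the unit case: Leibniz obstruction along `∂/∂T` on the exceptional curve
      have hy : algebraMap A L (ψ u * (ψ cc * ug j + ψ (c i) * r) ^ e * ψ (c i) ^ (2 * e % p)) =
          algebraMap A L (ψ u * (ψ cc * ug j + ψ (c i) * r) ^ e) := by
        rw [hr0, pow_zero, mul_one]
      have hobs : ∀ c' : L, algebraMap A L (ψ u * (ψ cc * ug j + ψ (c i) * r) ^ e) - c' ^ p ∈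
          maximalIdeal L → algebraMap A L (ψ u * (ψ cc * ug j + ψ (c i) * r) ^ e) - c' ^ p ∉
          maximalIdeal L ^ 2 := fun c' hc' =>
        chart_unit_obstruction c i L ψ ug ε hεC hεX 𝔓 h𝔓 p hp hc j hij hW u cc hu hcc e he r c' hc'
      by_cases hex : ∃ c' : L,
          algebraMap A L (ψ u * (ψ cc * ug j + ψ (c i) * r) ^ e) - c' ^ p ∈ maximalIdeal L
      · obtain ⟨c', hc'⟩ := hex
        exact Or.inr (Or.inr ⟨_, c', hy, hc', hobs c' hc'⟩)
      · exact Or.inr (Or.inl ⟨_, hunit, hy, fun c' h => hex ⟨c', h⟩⟩)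
    · -- toroidal with `m = 1` along `c_i`
      obtain ⟨d, hd0, t, htspan, hdimL, ht0⟩ := stub_extendParameter _ ht₁mem ht₁sq
      refine Or.inl ⟨d, 1, Nat.one_le_of_lt hd0, t, ![2 * e % p], _, hunit, htspan, hdimL,
        one_pos, ?_, ?_⟩
      · intro k
        fin_cases k
        exact hr'ndvd hr0
      · have h0 : t (Fin.castLE (Nat.one_le_of_lt hd0) 0) = algebraMap A L (ψ (c i)) :=
          (congrArg t (Fin.ext rfl)).trans ht0
        rw [Fin.prod_univ_one, h0, map_mul, map_pow]
        rfl


end Summit.ResolutionOfSingularities.ResolutionOfSingularities.Theorems.RadicialJung.CleanModels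

end
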